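import Literature.AlgebraicGeometry.Resolution.StrictTransformOpenImmersion
import Literature.AlgebraicGeometry.Resolution.StrictTransformTargetLocality
import Mathlib.AlgebraicGeometry.Morphisms.Proper
import HarnessLib

/-!
# Transport lemmas for strict transforms; normalised towers of admissible blowing ups

Topic: `Literature/AlgebraicGeometry/Resolution`. Bookkeeping for the iterated admissible blowing
ups in the Stacks Project's proof of Nagata's compactification theorem (Tags 0F3W, 0F3X, 0F40,
0F41), where one repeatedly "replaces `Xᵢ` by a `Vᵢ`-admissible blowing up and `X₁₂` by its
strict transform". The strict transform of `f : X → S` along `b : S' → S` with respect to the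
centre `V(𝓘)` (Stacks 080D, `blowupStrictTransform f b 𝓘`) only depends on the open
`S ∖ V(𝓘)`; to compose strict transforms along towers we keep every centre NORMALISED, i.e. with
support exactly the complement of the (preimage of the) fixed open `V`, which is always possible
(multiply the centre by the exceptional ideal of the previous stage, which is invertible, so the
blowing up does not change: `IsBlowup.mul_of_isEffectiveCartier`). All PROVED:

* instances: the strict transform `X' → S'` of a separated / quasi-compact / locally of finite
  type / proper morphism is again so;
* `isIso_blowupStrictTransformMap_morphismRestrict_of_le` — an isomorphism over `N ⊆ S ∖ V(𝓘)`
  stays an isomorphism over `b⁻¹N`;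
* `blowupStrictTransformMap_congr_centre` — centres with the same support give the same strict
  transform; `blowupStrictTransformMap_iff_of_iso_base` — isomorphic (over `S`) morphisms
  `S' → S` give isomorphic strict transforms; `congr_subschemeι` — equal ideal sheaves;
* `isIso_morphismRestrict_opensRange_iff` — the strict transform `X' → S'` is an isomorphism over
  the image of an open immersion `j : V → S'` iff the strict transform along `j ≫ b` is an
  isomorphism (target locality, Stacks 080C);
* `exists_isBlowup_normalised` — a first `V`-admissible blowing up with centre supported on
  exactly `S ∖ V`; `IsBlowup.isIso_morphismRestrict_of_support_eq`,
  `IsBlowup.isSchemeTheoreticallyDominant_ι_preimage` — along a normalised blowing up, `b` is an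
  isomorphism over `V` and `b⁻¹V` is retrocompact and schematically dense;
* `IsBlowup.normalised_comp` — **composition of normalised admissible blowing ups**: if
  `b : S₁ → S` is the blowing up in `𝓠` with `V(𝓠) = S ∖ V` and `b' : S₂ → S₁` is a
  `b⁻¹V`-admissible blowing up in `𝓒`, then `b'` is also the blowing up in the normalised
  centre `𝓒 · 𝓠𝒪_{S₁}` (support exactly `S₁ ∖ b⁻¹V`) and `b' ≫ b` is the blowing up in a centre
  of finite type with support exactly `S ∖ V` (Stacks 080L plus normalisation).

## References

* The Stacks Project, Tags 080C, 080D, 080L, 0F3W, 0F40. [StacksProject]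
-/

noncomputable section

-- Mathlib's pull-back API is stated through `abbrev`s over `limit`; as in Mathlib's own
-- algebraic-geometry files we let `simp`/unification see through them.
set_option backward.isDefEq.respectTransparency false

open CategoryTheory CategoryTheory.Limits AlgebraicGeometry TopologicalSpace
open Literature.AlgebraicGeometry.Morphisms

namespace Literature.AlgebraicGeometry.Resolution

universe u

/-! ## Instances for the strict transform map -/

section Instances

variable {X S S' : Scheme.{u}} (f : X ⟶ S) (b : S' ⟶ S) (I : S.IdealSheafData)

/-- The strict transform of a separated morphism is separated. [folklore] -/
instance isSeparated_blowupStrictTransformMap [IsSeparated f] :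
    IsSeparated (blowupStrictTransformMap f b I) :=
  inferInstanceAs (IsSeparated (blowupStrictTransformι f b I ≫ pullback.snd f b))

/-- The strict transform of a quasi-compact morphism is quasi-compact. [folklore] -/
instance quasiCompact_blowupStrictTransformMap [QuasiCompact f] :
    QuasiCompact (blowupStrictTransformMap f b I) :=
  inferInstanceAs (QuasiCompact (blowupStrictTransformι f b I ≫ pullback.snd f b))

/-- The strict transform of a morphism locally of finite type is locally of finite type.
[folklore] -/
instance locallyOfFiniteType_blowupStrictTransformMap [LocallyOfFiniteType f] :
    LocallyOfFiniteType (blowupStrictTransformMap f b I) :=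
  inferInstanceAs (LocallyOfFiniteType (blowupStrictTransformι f b I ≫ pullback.snd f b))

/-- The strict transform of a universally closed morphism is universally closed. [folklore] -/
instance universallyClosed_blowupStrictTransformMap [UniversallyClosed f] :
    UniversallyClosed (blowupStrictTransformMap f b I) :=
  inferInstanceAs (UniversallyClosed (blowupStrictTransformι f b I ≫ pullback.snd f b))

/-- The strict transform of a proper morphism is proper. [folklore] -/
instance isProper_blowupStrictTransformMap [IsProper f] : IsProper (blowupStrictTransformMap f b I) :=
  inferInstanceAs (IsProper (blowupStrictTransformι f b I ≫ pullback.snd f b))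

end Instances

/-! ## Transport -/

section Transport

variable {X S S' : Scheme.{u}} (f : X ⟶ S) (b : S' ⟶ S) (I : S.IdealSheafData)

/-- **An isomorphism over `N ⊆ S ∖ V(𝓘)` stays an isomorphism over `b⁻¹N` after strict
transform.** [cite: StacksProject, Tag 080D] -/
theorem isIso_blowupStrictTransformMap_morphismRestrict_of_le (hE : IsEffectiveCartier (I.comap b))
    {N : S.Opens} (hN : N ≤ centreCompl I) [IsIso (f ∣_ N)] :
    IsIso (blowupStrictTransformMap f b I ∣_ b ⁻¹ᵁ N) := by
  haveI := isIso_blowupStrictTransformι_morphismRestrict f b I hE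
  have hle : (pullback.snd f b) ⁻¹ᵁ (b ⁻¹ᵁ N) ≤ (pullback.snd f b) ⁻¹ᵁ (b ⁻¹ᵁ centreCompl I) :=
    fun x hx => hN hx
  haveI : IsIso (blowupStrictTransformι f b I ∣_ (pullback.snd f b) ⁻¹ᵁ (b ⁻¹ᵁ N)) :=
    Morphisms.isIso_morphismRestrict_of_le (blowupStrictTransformι f b I) hle
  haveI : IsIso ((pullback.snd f b) ∣_ b ⁻¹ᵁ N) := Morphisms.isIso_morphismRestrict_pullback_snd f b N
  exact Morphisms.isIso_morphismRestrict_comp (blowupStrictTransformι f b I) (pullback.snd f b) _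

/-- Equal ideal sheaves cut out the same closed subscheme: transport of a property of the
composite `V(K) → T → S'`. [folklore] -/
theorem congr_subschemeι (P : MorphismProperty Scheme.{u}) {T W : Scheme.{u}} {K₁ K₂ : T.IdealSheafData}
    (h : K₁ = K₂) (s : T ⟶ W) : P (K₁.subschemeι ≫ s) ↔ P (K₂.subschemeι ≫ s) := by
  subst h
  rfl

/-- **Centres with the same support have the same strict transforms.** [cite: StacksProject, Tag 080D] -/
theorem blowupStrictTransformMap_congr_centre (P : MorphismProperty Scheme.{u}) [P.RespectsIso]
    {I I' : S.IdealSheafData} (h : centreCompl I = centreCompl I')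
    [QuasiCompact ((pullback.snd f b) ⁻¹ᵁ (b ⁻¹ᵁ centreCompl I)).ι] :
    P (blowupStrictTransformMap f b I) ↔ P (blowupStrictTransformMap f b I') :=
  subschemeι_ker_ι_comp_iff_of_iso (𝟙 (pullback f b)) (pullback.snd f b) (pullback.snd f b) _ _ P
    (Category.id_comp _) (by rw [h]; rfl)

/-- **Isomorphic `S`-schemes `S'₁ ≅ S'₂` give isomorphic strict transforms**: a property
respecting isomorphisms holds for `X'₂ → S'₂` iff it holds for `X'₁ → S'₁ ≅ S'₂`.
[cite: StacksProject, Tag 080D] -/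
theorem blowupStrictTransformMap_iff_of_iso_base (P : MorphismProperty Scheme.{u}) [P.RespectsIso]
    {S₁' S₂' : Scheme.{u}} (b₁ : S₁' ⟶ S) (b₂ : S₂' ⟶ S) (e : S₁' ≅ S₂') (he : e.hom ≫ b₂ = b₁)
    [QuasiCompact ((pullback.snd f b₂) ⁻¹ᵁ (b₂ ⁻¹ᵁ centreCompl I)).ι] :
    P (blowupStrictTransformMap f b₂ I) ↔ P (blowupStrictTransformMap f b₁ I) := by
  set E : pullback f b₁ ⟶ pullback f b₂ := pullback.map f b₁ f b₂ (𝟙 X) e.hom (𝟙 S)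
    (by rw [Category.comp_id, Category.id_comp]) (by rw [Category.comp_id, he]) with hEdef
  haveI : IsIso E := by rw [hEdef]; infer_instance
  have key := subschemeι_ker_ι_comp_iff_of_iso E (pullback.snd f b₂) (pullback.snd f b₁ ≫ e.hom)
    ((pullback.snd f b₂) ⁻¹ᵁ (b₂ ⁻¹ᵁ centreCompl I)) ((pullback.snd f b₁) ⁻¹ᵁ (b₁ ⁻¹ᵁ centreCompl I))
    P (by rw [hEdef, pullback.lift_snd]) (by
      simp only [← Scheme.Hom.comp_preimage]
      rw [hEdef, pullback.lift_snd_assoc, Category.assoc, he])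
  change P (((pullback.snd f b₂) ⁻¹ᵁ (b₂ ⁻¹ᵁ centreCompl I)).ι.ker.subschemeι ≫ pullback.snd f b₂) ↔
    P (((pullback.snd f b₁) ⁻¹ᵁ (b₁ ⁻¹ᵁ centreCompl I)).ι.ker.subschemeι ≫ pullback.snd f b₁)
  rw [key, ← Category.assoc, P.cancel_right_of_respectsIso]

variable {V : Scheme.{u}} (j : V ⟶ S') [IsOpenImmersion j]

/-- **Target locality for being an isomorphism**: the strict transform `X' → S'` is an
isomorphism over the image of an open immersion `j : V → S'` iff the strict transform of `f`
along `j ≫ b` (which is the base change of `X' → S'` along `j`) is an isomorphism.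
[cite: StacksProject, Tag 080C] -/
theorem isIso_morphismRestrict_opensRange_iff (hE : IsEffectiveCartier (I.comap b)) :
    IsIso (blowupStrictTransformMap f b I ∣_ j.opensRange) ↔
      IsIso (blowupStrictTransformMap f (j ≫ b) I) := by
  have sq := isPullback_blowupStrictTransform_over f b I j
  -- the strict transform along `j ≫ b`, as the closed subscheme cut out by the restricted ideal
  have hker := ker_blowupStrictTransformι_over f b I j hE
  have h1 : IsIso (blowupStrictTransformMap f (j ≫ b) I) ↔
      IsIso ((((pullback.snd f b) ⁻¹ᵁ (b ⁻¹ᵁ centreCompl I)).ι.ker.comap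
        (strictTransformOverι f b j)).subschemeι ≫ pullback.snd f (j ≫ b)) :=
    congr_subschemeι (MorphismProperty.isomorphisms Scheme.{u}) hker (pullback.snd f (j ≫ b))
  rw [h1]
  -- which is the base change of `X' → S'` along `j`
  have h2 : (((pullback.snd f b) ⁻¹ᵁ (b ⁻¹ᵁ centreCompl I)).ι.ker.comap
      (strictTransformOverι f b j)).subschemeι ≫ pullback.snd f (j ≫ b) =
      sq.isoPullback.hom ≫ pullback.snd _ j := (sq.isoPullback_hom_snd).symm
  change IsIso ((((pullback.snd f b) ⁻¹ᵁ (b ⁻¹ᵁ centreCompl I)).ι.ker.subschemeι ≫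
      pullback.snd f b) ∣_ j.opensRange) ↔ _
  rw [h2]
  have h3 : IsIso (sq.isoPullback.hom ≫ pullback.snd
      (((pullback.snd f b) ⁻¹ᵁ (b ⁻¹ᵁ centreCompl I)).ι.ker.subschemeι ≫ pullback.snd f b) j) ↔
      IsIso (pullback.snd
        (((pullback.snd f b) ⁻¹ᵁ (b ⁻¹ᵁ centreCompl I)).ι.ker.subschemeι ≫ pullback.snd f b) j) := by
    constructor
    · intro h
      exact IsIso.of_isIso_comp_left sq.isoPullback.hom _
    · intro h
      infer_instance
  rw [h3]
  exact ((MorphismProperty.isomorphisms Scheme.{u}).arrow_mk_iso_iff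
    (morphismRestrictOpensRange _ j)).trans (by rfl)

end Transport

/-! ## Normalised admissible blowing ups -/

section Normalised

variable {S : Scheme.{u}} [CompactSpace S] [QuasiSeparatedSpace S] (V : S.Opens)

/-- **A first normalised `V`-admissible blowing up**: the blowing up of `S` in an ideal sheaf of
finite type with support exactly `S ∖ V` (Stacks, More on Flatness, Remark 38.30.1, as used in the proof
of Tag 081S: "we may do a first `U`-admissible blowup and assume the complement `S ∖ U` is the
support of an effective Cartier divisor"). [cite: StacksProject, Tag 081S (proof)] -/
theorem exists_isBlowup_normalised (hV : IsCompact (V : Set S)) :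
    ∃ (Q : S.IdealSheafData) (S₁ : Scheme.{u}) (b : S₁ ⟶ S), (∀ W : S.affineOpens, (Q.ideal W).FG) ∧
      (Q.support : Set S) = (V : Set S)ᶜ ∧ IsBlowup b Q ∧ IsProper b := by
  obtain ⟨Q, hQfg, hQsupp⟩ := exists_fg_support_eq_compl V hV
  obtain ⟨S₁, b, hb⟩ := exists_isBlowup S Q
  exact ⟨Q, S₁, b, hQfg, hQsupp, hb, IsBlowup.isProper_of_fg hQfg hb⟩

variable {V} {S₁ : Scheme.{u}} {b : S₁ ⟶ S} {Q : S.IdealSheafData}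

omit [CompactSpace S] [QuasiSeparatedSpace S] in
/-- Along a normalised blowing up, `b` is an isomorphism over `V`. [cite: StacksProject, Tag 02OS] -/
theorem IsBlowup.isIso_morphismRestrict_of_support_eq (hb : IsBlowup b Q)
    (hQ : (Q.support : Set S) = (V : Set S)ᶜ) : IsIso (b ∣_ V) := by
  rw [← centreCompl_eq_of_support_eq hQ]
  exact hb.isIso_compl

omit [CompactSpace S] [QuasiSeparatedSpace S] in
/-- Along a normalised blowing up, `b⁻¹V ↪ S₁` is quasi-compact and scheme-theoretically dominant
(it is the complement of the exceptional effective Cartier divisor). [cite: StacksProject, Tag 07ZU] -/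
theorem IsBlowup.quasiCompact_and_isSchemeTheoreticallyDominant_ι_preimage (hb : IsBlowup b Q)
    (hQ : (Q.support : Set S) = (V : Set S)ᶜ) :
    QuasiCompact (b ⁻¹ᵁ V).ι ∧ IsSchemeTheoreticallyDominant (b ⁻¹ᵁ V).ι := by
  rw [← centreCompl_eq_of_support_eq hQ, preimage_centreCompl]
  exact ⟨hb.isEffectiveCartier.quasiCompact_ι_centreCompl,
    hb.isEffectiveCartier.isSchemeTheoreticallyDominant_ι_centreCompl⟩

/-- **Composition of normalised admissible blowing ups.** Let `b : S₁ → S` be the blowing up in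
`𝓠` (of finite type, support exactly `S ∖ V`) and `b' : S₂ → S₁` the blowing up in `𝓒` (of
finite type, support disjoint from `b⁻¹V`). Then `b'` is also the blowing up in the normalised
centre `𝓒 · 𝓠𝒪_{S₁}`, of finite type with support exactly `S₁ ∖ b⁻¹V`, and `b' ≫ b` is the
blowing up in an ideal sheaf of finite type with support exactly `S ∖ V`.
[cite: StacksProject, Tag 080L] -/
theorem IsBlowup.normalised_comp (hb : IsBlowup b Q) (hQfg : ∀ W : S.affineOpens, (Q.ideal W).FG)
    (hQ : (Q.support : Set S) = (V : Set S)ᶜ) {S₂ : Scheme.{u}} {b' : S₂ ⟶ S₁}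
    {C : S₁.IdealSheafData} (hb' : IsBlowup b' C) (hCfg : ∀ W : S₁.affineOpens, (C.ideal W).FG)
    (hC : Disjoint ((b ⁻¹ᵁ V : S₁.Opens) : Set S₁) (C.support : Set S₁)) :
    IsBlowup b' (C * Q.comap b) ∧ (∀ W : S₁.affineOpens, ((C * Q.comap b).ideal W).FG) ∧
      ((C * Q.comap b).support : Set S₁) = ((b ⁻¹ᵁ V : S₁.Opens) : Set S₁)ᶜ ∧
      ∃ Q₂ : S.IdealSheafData, (∀ W : S.affineOpens, (Q₂.ideal W).FG) ∧
        (Q₂.support : Set S) = (V : Set S)ᶜ ∧ IsBlowup (b' ≫ b) Q₂ := by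
  have hE : IsEffectiveCartier (Q.comap b) := hb.isEffectiveCartier
  have hbJ : IsBlowup b' (C * Q.comap b) := hb'.mul_of_isEffectiveCartier hE
  have hJfg : ∀ W : S₁.affineOpens, ((C * Q.comap b).ideal W).FG := fun W => by
    rw [Scheme.IdealSheafData.ideal_mul, Pi.mul_apply]
    exact (hCfg W).mul (hE.fg_ideal W)
  have h1 : ((Q.comap b).support : Set S₁) = ((b ⁻¹ᵁ V : S₁.Opens) : Set S₁)ᶜ := by
    rw [Scheme.IdealSheafData.support_comap]
    ext x
    change b x ∈ (Q.support : Set S) ↔ ¬ (b x ∈ (V : Set S))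
    rw [hQ, Set.mem_compl_iff]
  have hJsupp : ((C * Q.comap b).support : Set S₁) = ((b ⁻¹ᵁ V : S₁.Opens) : Set S₁)ᶜ := by
    rw [Scheme.IdealSheafData.support_mul, TopologicalSpace.Closeds.coe_sup, h1]
    exact Set.union_eq_right.mpr hC.subset_compl_left
  refine ⟨hbJ, hJfg, hJsupp, ?_⟩
  have hVQ : Disjoint ((V : S.Opens) : Set S) (Q.support : Set S) := by
    rw [hQ]; exact disjoint_compl_right
  have hVJ : Disjoint ((b ⁻¹ᵁ V : S₁.Opens) : Set S₁) ((C * Q.comap b).support : Set S₁) := by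
    rw [hJsupp]; exact disjoint_compl_right
  obtain ⟨Q', hQ'fg, hQ'V, hbQ'⟩ := hb.exists_isBlowup_comp_admissible V hQfg hVQ hbJ hJfg hVJ
  -- normalise: multiply by `Q`, invertible upstairs
  have hQb : IsEffectiveCartier (Q.comap (b' ≫ b)) := by
    have h : IsEffectiveCartier ((C * Q.comap b).comap b') := hbJ.isEffectiveCartier
    rw [comap_mul] at h
    rw [Scheme.IdealSheafData.comap_comp]
    exact h.of_mul_right
  refine ⟨Q' * Q, fun W => ?_, ?_, hbQ'.mul_of_isEffectiveCartier_comap hQb⟩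
  · rw [Scheme.IdealSheafData.ideal_mul, Pi.mul_apply]
    exact (hQ'fg W).mul (hQfg W)
  · rw [Scheme.IdealSheafData.support_mul, TopologicalSpace.Closeds.coe_sup, hQ]
    exact Set.union_eq_right.mpr hQ'V.subset_compl_left

end Normalised

end Literature.AlgebraicGeometry.Resolution

end
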